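import Summits.AtomisticToContinuum.BoseEinsteinCondensation.Theorems.BECThomsonPrincipleGDTransferSeededPlainInteractionBracket

/-!
# Route `BECThomsonPrinciple`, crux `GDTransfer` (stmt-AtomisticToContinuum-9482), line `seeded-continuity`:
# stub `stub_plainInteraction`, part 4 of 4 — assembly: `PlainInteractionBound` for the plain pair

Final file (part 4 of 4) of the registered stub `stub_plainInteraction` (skeleton v3 of line `seeded-continuity`;
`Sig.stub_plainInteraction := PlainInteractionBound`), continuing parts 1–3 (`…SeededPlainInteractionForms`,
`…SeededPlainInteractionPairs`, `…SeededPlainInteractionBracket`): the scaled pair `ζ₊ = N^{-1/2}BΨ`, `ζ₋ = N^{-1/2}B'Ψ`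
carries the factor `N⁻¹` (`defect_eq`), the double-commutator form with the full weight `V = Σ_{p<q} v^per(x_p − x_q)`
splits over the pairs (`bracket_split`), the pair energies are bounded by the energy `Σ_{p<q} ∫v^per_pq|Ψ|² ≤ E(Ψ)`
(`sum_pairEnergy_le`), and the local bound of one pair (part 3) with two Cauchy–Schwarz steps over the pairs (part 2)
gives `|𝒟^V(Ψ)| ≤ C(ρ + √(ρE(Ψ)/N))`, `ρ = N/L³`, with `C = 8(‖v‖₁ + √‖v‖₁) + 1` — no `n̂₀^{-1/2}`, no anomaly, no
dependence on the state beyond its energy (`stub_plainInteraction : Sig.stub_plainInteraction`).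
All [folklore] (KennedyLiebShastry1988 §2; arXiv:1211.2778 §2; LSSY2005 App. A).
-/

noncomputable section

open MeasureTheory Filter
open scoped ENNReal NNReal ComplexConjugate

namespace Summit.AtomisticToContinuum.BoseEinsteinCondensation.Cruxes.GDTransfer.Seeded

namespace PlainInteraction

open Literature.MathematicalPhysics.QuantumManyBody.BoseGas
open Summit.AtomisticToContinuum.BoseEinsteinCondensation.Theorems.GaussianDominationCan.Negative
open Summit.AtomisticToContinuum.BoseEinsteinCondensation.Cruxes.GDTransfer.DysonDressedWitness
open Lnss Sector

variable {N m : ℕ} {L : ℝ}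

/-! ## Assembly: the scaling `N⁻¹`, the splitting over pairs, the pair energies, the constant -/

section Assembly

variable {v : ℝ → ℝ≥0∞}

/-- **Step 0 — the scaled pair carries `N⁻¹`**: with `B = Σ_i b_i`, `B' = Σ_i P_i^{(n)}` (so `ζ₊ = N^{-1/2}Bψ`,
`ζ₋ = N^{-1/2}B'ψ`, `ζ₊∘ζ₋ = N⁻¹BB'`, `ζ₋∘ζ₊ = N⁻¹B'B`),
`𝒟^V(ψ) = N⁻¹ Re[𝓥(Bψ,Bψ) + 𝓥(B'ψ,B'ψ) − 𝓥(BB'ψ,ψ) − 𝓥(B'Bψ,ψ)]`. [folklore] -/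
theorem defect_eq (v : ℝ → ℝ≥0∞) (L : ℝ) (n : Fin 3 → ℤ) (ψ : Config (m + 1) → ℂ) :
    plainInteractionDefect v m L n ψ = (((m + 1 : ℕ) : ℝ))⁻¹ *
      ((∫ X in cellN (m + 1) L, (((periodicInteraction v L X).toReal : ℝ) : ℂ) *
          (conj (∑ i, cellWave L n (X i) * cellAvg (m + 1) L i ψ X) *
            ∑ i, cellWave L n (X i) * cellAvg (m + 1) L i ψ X)) +
        (∫ X in cellN (m + 1) L, (((periodicInteraction v L X).toReal : ℝ) : ℂ) *
          (conj (∑ i, fourierAvg m L n i ψ X) * ∑ i, fourierAvg m L n i ψ X)) -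
        (∫ X in cellN (m + 1) L, (((periodicInteraction v L X).toReal : ℝ) : ℂ) *
          (conj (∑ i, cellWave L n (X i) *
            cellAvg (m + 1) L i (fun Y => ∑ j, fourierAvg m L n j ψ Y) X) * ψ X)) -
        ∫ X in cellN (m + 1) L, (((periodicInteraction v L X).toReal : ℝ) : ℂ) *
          (conj (∑ i, fourierAvg m L n i (fun Y => ∑ j, cellWave L n (Y j) * cellAvg (m + 1) L j ψ Y) X) *
            ψ X)).re := by
  obtain ⟨c, hc⟩ : ∃ c : ℂ, c = ((Real.sqrt ((m + 1 : ℕ) : ℝ) : ℂ))⁻¹ := ⟨_, rfl⟩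
  have hcc : conj c = c := by rw [hc, map_inv₀, Complex.conj_ofReal]
  have hc2 : c * c = (((((m + 1 : ℕ) : ℝ))⁻¹ : ℝ) : ℂ) := by
    rw [hc, ← mul_inv, ← Complex.ofReal_mul, Real.mul_self_sqrt (Nat.cast_nonneg _), Complex.ofReal_inv]
  -- the two compositions
  have h1 : ∀ i, cellAvg (m + 1) L i (plainDown m L n ψ) =
      fun X => c * cellAvg (m + 1) L i (fun Y => ∑ j, fourierAvg m L n j ψ Y) X := fun i => by
    rw [hc]; exact cellAvg_const_mul i _ _
  have h2 : ∀ i, fourierAvg m L n i (plainUp m L n ψ) =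
      fun X => c * fourierAvg m L n i (fun Y => ∑ j, cellWave L n (Y j) * cellAvg (m + 1) L j ψ Y) X := fun i => by
    rw [hc]; exact fourierAvg_mul_flat n i (fun _ _ => rfl) _
  have hUD : plainUp m L n (plainDown m L n ψ) = fun X => (c * c) *
      ∑ i, cellWave L n (X i) * cellAvg (m + 1) L i (fun Y => ∑ j, fourierAvg m L n j ψ Y) X := by
    funext X
    simp only [plainUp, h1, Finset.mul_sum, ← hc]
    exact Finset.sum_congr rfl fun i _ => by ring
  have hDU : plainDown m L n (plainUp m L n ψ) = fun X => (c * c) *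
      ∑ i, fourierAvg m L n i (fun Y => ∑ j, cellWave L n (Y j) * cellAvg (m + 1) L j ψ Y) X := by
    funext X
    simp only [plainDown, h2, Finset.mul_sum, ← hc]
    exact Finset.sum_congr rfl fun i _ => by ring
  have hlin : ∀ I₁ I₂ I₃ I₄ : ℂ, c * (c * I₁) + c * (c * I₂) - c * c * I₃ - c * c * I₄ =
      (c * c) * (I₁ + I₂ - I₃ - I₄) := fun _ _ _ _ => by ring
  unfold plainInteractionDefect vform
  rw [hUD, hDU]
  simp only [plainUp, plainDown, ← hc]
  rw [form_const_mul_left, form_const_mul_right, form_const_mul_left, form_const_mul_right, form_const_mul_left,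
    form_const_mul_left]
  simp only [map_mul, hcc]
  rw [hlin, hc2, Complex.re_ofReal_mul]

/-- **Step 2 — splitting over pairs**: with the full weight `V = Σ_{p<q} v^per(x_p − x_q)` the double-commutator form is
the sum over `p < q` of the pair forms. [folklore] -/
theorem bracket_split (hv : IsRepulsiveFiniteRange v) (hfc : IsFiniteContinuous v) (hL : L ≠ 0) (n : Fin 3 → ℤ)
    {ψ : Config (m + 1) → ℂ} (hψ : Continuous ψ) :
    ((∫ X in cellN (m + 1) L, (((periodicInteraction v L X).toReal : ℝ) : ℂ) *
          (conj (∑ i, cellWave L n (X i) * cellAvg (m + 1) L i ψ X) *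
            ∑ i, cellWave L n (X i) * cellAvg (m + 1) L i ψ X)) +
        (∫ X in cellN (m + 1) L, (((periodicInteraction v L X).toReal : ℝ) : ℂ) *
          (conj (∑ i, fourierAvg m L n i ψ X) * ∑ i, fourierAvg m L n i ψ X)) -
        (∫ X in cellN (m + 1) L, (((periodicInteraction v L X).toReal : ℝ) : ℂ) *
          (conj (∑ i, cellWave L n (X i) *
            cellAvg (m + 1) L i (fun Y => ∑ j, fourierAvg m L n j ψ Y) X) * ψ X)) -
        ∫ X in cellN (m + 1) L, (((periodicInteraction v L X).toReal : ℝ) : ℂ) *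
          (conj (∑ i, fourierAvg m L n i (fun Y => ∑ j, cellWave L n (Y j) * cellAvg (m + 1) L j ψ Y) X) *
            ψ X)) =
      ∑ p : Fin (m + 1), ∑ q ∈ (Finset.univ : Finset (Fin (m + 1))).filter (fun q => p < q),
        ((∫ X in cellN (m + 1) L, (((periodizedPotential v L (X p - X q)).toReal : ℝ) : ℂ) *
            (conj (∑ i, cellWave L n (X i) * cellAvg (m + 1) L i ψ X) *
              ∑ i, cellWave L n (X i) * cellAvg (m + 1) L i ψ X)) +
          (∫ X in cellN (m + 1) L, (((periodizedPotential v L (X p - X q)).toReal : ℝ) : ℂ) *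
            (conj (∑ i, fourierAvg m L n i ψ X) * ∑ i, fourierAvg m L n i ψ X)) -
          (∫ X in cellN (m + 1) L, (((periodizedPotential v L (X p - X q)).toReal : ℝ) : ℂ) *
            (conj (∑ i, cellWave L n (X i) *
              cellAvg (m + 1) L i (fun Y => ∑ j, fourierAvg m L n j ψ Y) X) * ψ X)) -
          ∫ X in cellN (m + 1) L, (((periodizedPotential v L (X p - X q)).toReal : ℝ) : ℂ) *
            (conj (∑ i, fourierAvg m L n i (fun Y => ∑ j, cellWave L n (Y j) * cellAvg (m + 1) L j ψ Y) X) *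
              ψ X)) := by
  have hb : ∀ i, Continuous fun X => cellWave L n (X i) * cellAvg (m + 1) L i ψ X := fun i => continuous_up n i hψ
  have hF : ∀ i, Continuous (fourierAvg m L n i ψ) := fun i => continuous_fourierAvg n i hψ
  have hB : Continuous fun X => ∑ i, cellWave L n (X i) * cellAvg (m + 1) L i ψ X :=
    continuous_finsetSum _ fun i _ => hb i
  have hB' : Continuous fun X => ∑ i, fourierAvg m L n i ψ X := continuous_finsetSum _ fun i _ => hF i
  have hBB' : Continuous fun X => ∑ i, cellWave L n (X i) *
      cellAvg (m + 1) L i (fun Y => ∑ j, fourierAvg m L n j ψ Y) X :=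
    continuous_finsetSum _ fun i _ => continuous_up n i hB'
  have hB'B : Continuous fun X => ∑ i, fourierAvg m L n i (fun Y => ∑ j, cellWave L n (Y j) * cellAvg (m + 1) L j ψ Y) X :=
    continuous_finsetSum _ fun i _ => continuous_fourierAvg n i hB
  have split : ∀ {f g : Config (m + 1) → ℂ}, Continuous f → Continuous g →
      ∫ X in cellN (m + 1) L, (((periodicInteraction v L X).toReal : ℝ) : ℂ) * (conj (f X) * g X) =
        ∑ p : Fin (m + 1), ∑ q ∈ (Finset.univ : Finset (Fin (m + 1))).filter (fun q => p < q),
          ∫ X in cellN (m + 1) L, (((periodizedPotential v L (X p - X q)).toReal : ℝ) : ℂ) * (conj (f X) * g X) := by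
    intro f g hf hg
    simp_rw [toReal_periodicInteraction hv hfc hL]
    rw [form_sum_weight _ (fun p _ => continuous_finsetSum _ fun q _ => continuous_pairWeight hv hfc hL p q) hf hg]
    exact Finset.sum_congr rfl fun p _ => form_sum_weight _ (fun q _ => continuous_pairWeight hv hfc hL p q) hf hg
  rw [split hB hB, split hB' hB', split hBB' hψ, split hB'B hψ]
  simp only [Finset.sum_add_distrib, Finset.sum_sub_distrib]

/-- **The pair energies are bounded by the energy**: `Σ_{p<q} ∫ v^per(x_p − x_q)|Ψ|² ≤ E(Ψ)` (the interaction part of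
the periodic energy; the kinetic part is dropped). [folklore] -/
theorem sum_pairEnergy_le (hv : IsRepulsiveFiniteRange v) (hfc : IsFiniteContinuous v) (hL : L ≠ 0)
    (Ψ : PeriodicTrialState (m + 1) L) (hE : periodicEnergy v Ψ ≠ ⊤) :
    ∑ p : Fin (m + 1), ∑ q ∈ (Finset.univ : Finset (Fin (m + 1))).filter (fun q => p < q),
        ∫ X in cellN (m + 1) L, (periodizedPotential v L (X p - X q)).toReal * ‖Ψ.ψ X‖ ^ 2 ≤
      (periodicEnergy v Ψ).toReal := by
  have hψ : Continuous Ψ.ψ := Ψ.contDiff.continuous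
  have h0 : ∀ p q : Fin (m + 1),
      0 ≤ ∫ X in cellN (m + 1) L, (periodizedPotential v L (X p - X q)).toReal * ‖Ψ.ψ X‖ ^ 2 := fun p q =>
    integral_nonneg fun X => mul_nonneg ENNReal.toReal_nonneg (sq_nonneg _)
  rw [← ENNReal.ofReal_le_iff_le_toReal hE, ENNReal.ofReal_sum_of_nonneg fun p _ => Finset.sum_nonneg fun q _ => h0 p q]
  calc ∑ p : Fin (m + 1), ENNReal.ofReal (∑ q ∈ (Finset.univ : Finset (Fin (m + 1))).filter (fun q => p < q),
        ∫ X in cellN (m + 1) L, (periodizedPotential v L (X p - X q)).toReal * ‖Ψ.ψ X‖ ^ 2)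
      = ∑ p : Fin (m + 1), ∑ q ∈ (Finset.univ : Finset (Fin (m + 1))).filter (fun q => p < q),
          ∫⁻ X in cellN (m + 1) L, periodizedPotential v L (X p - X q) * ((‖Ψ.ψ X‖₊ : ℝ≥0∞)) ^ 2 := by
        refine Finset.sum_congr rfl fun p _ => ?_
        rw [ENNReal.ofReal_sum_of_nonneg fun q _ => h0 p q]
        exact Finset.sum_congr rfl fun q _ => ofReal_integral_pairWeight_norm_sq hv hfc hL p q hψ
    _ = ∫⁻ X in cellN (m + 1) L, periodicInteraction v L X * ((‖Ψ.ψ X‖₊ : ℝ≥0∞)) ^ 2 :=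
        (Bare.lintegral_interaction_mul_eq_sum hv.1 L (Bare.measurable_nnnorm_sq hψ.measurable)).symm
    _ ≤ periodicEnergy v Ψ := by
        unfold periodicEnergy
        exact lintegral_mono fun X => le_add_self

end Assembly

end PlainInteraction

section Stub

open Literature.MathematicalPhysics.QuantumManyBody.BoseGas
open Summit.AtomisticToContinuum.BoseEinsteinCondensation.Theorems.GaussianDominationCan.Negative
open Summit.AtomisticToContinuum.BoseEinsteinCondensation.Cruxes.GDTransfer.DysonDressedWitness
open PlainInteraction

/-- **Registered stub `stub_plainInteraction`** (skeleton v3 of line `seeded-continuity`, crux `GDTransfer`,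
stmt-AtomisticToContinuum-9482): `PlainInteractionBound` — for every admissible finite continuous profile `v` there
is `C` (`= 8(‖v‖₁ + √‖v‖₁) + 1`) such that for every periodic trial state `Ψ` of finite energy and every mode `n` the
interaction double-commutator form of the plain pair `ζ₊ = N^{-1/2}a_n†a_0Ψ`, `ζ₋ = N^{-1/2}a_0†a_nΨ` satisfies
`|𝒟^V(Ψ)| ≤ C(ρ + √(ρE(Ψ)/N))`, `ρ = N/L³`.  Pair by pair: the slots outside the pair drop out of the real part
exactly (adjointness of `b_i`, `P_i^{(n)}` against the pair weight and the mixed commutation `b_iP_l^{(n)} = P_l^{(n)}b_i`),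
the four local entries are `≤ 2L⁻³‖v‖₁ + 2√(L⁻³‖v‖₁)√(∫v^per_{pq}|Ψ|²)` (Jensen in a slot, `∫_cell v^per = ‖v‖₁`, and
weighted Cauchy–Schwarz), and two Cauchy–Schwarz steps on the sum over pairs with `Σ_{p<q}∫v^per_{pq}|Ψ|² ≤ E(Ψ)`
give the bound — no `n̂₀^{-1/2}`, no anomaly, no dependence on the state beyond its energy. [folklore]
(KennedyLiebShastry1988 §2; arXiv:1211.2778 §2; LSSY2005 App. A) -/
theorem stub_plainInteraction : Sig.stub_plainInteraction := by
  intro v hv hfc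
  have hint : (∫⁻ x : Space, v ‖x‖) ≠ ⊤ := lintegral_ne_top_of_isFiniteContinuous hv hfc
  obtain ⟨nv, hnv⟩ : ∃ nv : ℝ, nv = (∫⁻ x : Space, v ‖x‖).toReal := ⟨_, rfl⟩
  have hnv0 : 0 ≤ nv := by rw [hnv]; exact ENNReal.toReal_nonneg
  refine ⟨8 * (nv + Real.sqrt nv) + 1, by positivity, ?_⟩
  intro m L hL n Ψ hE
  have hψ : Continuous Ψ.ψ := Ψ.contDiff.continuous
  have hψ1 : ∫ X in cellN (m + 1) L, ‖Ψ.ψ X‖ ^ 2 ≤ 1 := (integral_norm_sq_trialState Ψ).le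
  have hN : (0 : ℝ) < ((m + 1 : ℕ) : ℝ) := by positivity
  have hL3 : (0 : ℝ) < L ^ 3 := by positivity
  -- the slot constant `σ = L⁻³‖v‖₁`
  obtain ⟨σ, hσ⟩ : ∃ σ : ℝ, σ = ((ENNReal.ofReal (L ^ 3))⁻¹ * ∫⁻ x : Space, v ‖x‖).toReal := ⟨_, rfl⟩
  have hσ0 : 0 ≤ σ := by rw [hσ]; exact ENNReal.toReal_nonneg
  have hσeq : σ = nv / L ^ 3 := by
    rw [hσ, ENNReal.toReal_mul, ENNReal.toReal_inv, ENNReal.toReal_ofReal hL3.le, hnv, div_eq_inv_mul]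
  -- the energy and the pair energies
  set E : ℝ := (periodicEnergy v Ψ).toReal with hEdef
  have hE0 : 0 ≤ E := ENNReal.toReal_nonneg
  have hsum := sum_pairEnergy_le hv hfc hL.ne' Ψ hE
  -- Steps 0, 2 and the per-pair bounds
  rw [defect_eq v L n Ψ.ψ, bracket_split hv hfc hL.ne' n hψ, Complex.re_sum]
  simp_rw [Complex.re_sum]
  have key := abs_sum_pairs_le (N := m + 1) hσ0 (E := E)
    (fun p q => ((∫ X in cellN (m + 1) L, (((periodizedPotential v L (X p - X q)).toReal : ℝ) : ℂ) *
            (conj (∑ i, cellWave L n (X i) * cellAvg (m + 1) L i Ψ.ψ X) *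
              ∑ i, cellWave L n (X i) * cellAvg (m + 1) L i Ψ.ψ X)) +
          (∫ X in cellN (m + 1) L, (((periodizedPotential v L (X p - X q)).toReal : ℝ) : ℂ) *
            (conj (∑ i, fourierAvg m L n i Ψ.ψ X) * ∑ i, fourierAvg m L n i Ψ.ψ X)) -
          (∫ X in cellN (m + 1) L, (((periodizedPotential v L (X p - X q)).toReal : ℝ) : ℂ) *
            (conj (∑ i, cellWave L n (X i) *
              cellAvg (m + 1) L i (fun Y => ∑ j, fourierAvg m L n j Ψ.ψ Y) X) * Ψ.ψ X)) -
          ∫ X in cellN (m + 1) L, (((periodizedPotential v L (X p - X q)).toReal : ℝ) : ℂ) *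
            (conj (∑ i, fourierAvg m L n i (fun Y => ∑ j, cellWave L n (Y j) * cellAvg (m + 1) L j Ψ.ψ Y) X) *
              Ψ.ψ X)).re)
    (fun p q => ∫ X in cellN (m + 1) L, (periodizedPotential v L (X p - X q)).toReal * ‖Ψ.ψ X‖ ^ 2)
    (fun p q => integral_nonneg fun X => mul_nonneg ENNReal.toReal_nonneg (sq_nonneg _))
    (fun p q hpq => by
      have h := abs_re_pairBracket_le hL hv hfc n (ne_of_lt hpq) hψ hψ1
      rw [← hσ] at h
      exact h)
    hsum
  -- the arithmetic of the constant
  have hρE : ((m + 1 : ℕ) : ℝ) / L ^ 3 * E / ((m + 1 : ℕ) : ℝ) = E / L ^ 3 := by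
    field_simp
  have hsq : Real.sqrt σ * Real.sqrt E = Real.sqrt nv * Real.sqrt (E / L ^ 3) := by
    rw [← Real.sqrt_mul hσ0, ← Real.sqrt_mul hnv0, hσeq]
    congr 1
    field_simp
  rw [hρE, abs_mul, abs_of_pos (inv_pos.2 hN)]
  calc (((m + 1 : ℕ) : ℝ))⁻¹ * _ ≤ (((m + 1 : ℕ) : ℝ))⁻¹ *
        (8 * σ * ((m + 1 : ℕ) : ℝ) ^ 2 + 8 * ((m + 1 : ℕ) : ℝ) * (Real.sqrt σ * Real.sqrt E)) :=
        mul_le_mul_of_nonneg_left key (inv_nonneg.2 hN.le)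
    _ = 8 * nv * (((m + 1 : ℕ) : ℝ) / L ^ 3) + 8 * Real.sqrt nv * Real.sqrt (E / L ^ 3) := by
        rw [hsq, hσeq]
        field_simp
    _ ≤ (8 * (nv + Real.sqrt nv) + 1) * (((m + 1 : ℕ) : ℝ) / L ^ 3 + Real.sqrt (E / L ^ 3)) := by
        have hρ0 : 0 ≤ ((m + 1 : ℕ) : ℝ) / L ^ 3 := by positivity
        have hs0 : 0 ≤ Real.sqrt (E / L ^ 3) := Real.sqrt_nonneg _
        have hr0 : 0 ≤ Real.sqrt nv := Real.sqrt_nonneg _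
        nlinarith [mul_nonneg hnv0 hs0, mul_nonneg hr0 hρ0, mul_nonneg hnv0 hρ0, mul_nonneg hr0 hs0]

end Stub

end Summit.AtomisticToContinuum.BoseEinsteinCondensation.Cruxes.GDTransfer.Seeded

end
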